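import Summits.ResolutionOfSingularities.ResolutionOfSingularities.Theorems.FrobeniusLadderFInjectiveMacaulayficationGradedConeFiModelRel
import Summits.ResolutionOfSingularities.ResolutionOfSingularities.Theorems.FrobeniusLadderFInjectiveMacaulayficationCNConeFiModelRelBlowup
import Summits.ResolutionOfSingularities.ResolutionOfSingularities.Theorems.FrobeniusLadderFInjectiveMacaulayficationStrongPlusStepOfAffineBlowup
import HarnessLib

/-!
# (H3-gd-rel) WITH THE MODEL NAMED, and THE STRONG⁺ STEP IT PRODUCES
# (crux `FrobeniusLadder.FInjectiveMacaulayfication` stmt-ResolutionOfSingularities-15315, chain w45a; lead seat res-L1-w45a-lead-1 gen 3)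

[OURS · L1 W4.5a] AI-written; AI review is weaker than expert review. NOT a statement of any manuscript; no named fact.

* `gradedConeFiModelRel_affineBlowup` — the relative graded engine `GradedConeFiModelRel.gradedConeFiModelRel` (p499962) with the
  model NAMED: the crux clause holds at EVERY stalk of `affineBlowup (I_N R)` (same proof, closing with res-L1-w45a-stub-5's opened
  E6‴ `CNConeFiModelRelBlowup.affineBlowup_fiClause_of_cover`, p498340, instead of the `∃`-form).
* `gradedConeFiModelRel_strongPlusStep` — composed with stub-5's ABSTRACT STRONG⁺ WRAPPER `StrongPlusStepOfAffineBlowup.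
  strongPlusStep_of_affineBlowup` (p499685): for `η` the point of `Spec R` with `η.asIdeal = (x̄ⱼ : j ∈ J)` (a prime as soon as
  `f ∈ (X_J)`, i.e. the stratum lies on the hypersurface), the `∃`-clause of the registered hole-#3 stub
  `stub_confinedIsoStepStrongPlus` holds VERBATIM for `X₁ = Spec R`: a proper birational integral everywhere-Cohen–Macaulay model,
  an isomorphism exactly off `closure {η} = V(X_J) ∩ X`, with the full clause at every (non-closed) point over it. The radical
  computation `√(I_N R) = (x̄ⱼ : j ∈ J)` uses `x̄ⱼ^{cⱼ} ∈ I_N` and `I_N ⊆ (X_J)` (weights vanish off `J`).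
First instance: `E₈⁰ × 𝔸¹` (file `…E8LineGradedFiModel`, lead). No definitions, no named facts. [folklore]
-/

set_option linter.dupNamespace false

noncomputable section

open Literature.AlgebraicGeometry.Resolution AlgebraicGeometry MvPolynomial CategoryTheory

namespace Summit.ResolutionOfSingularities.ResolutionOfSingularities.Theorems.FInjectiveMacaulayfication.GradedConeFiModelRelBlowup

open Summit.ResolutionOfSingularities.ResolutionOfSingularities.Theorems.FInjectiveMacaulayfication
open WeightCoaction WeightedConeCore GradedConeFiModelRel

/-- **(H3-gd-rel, named model)** the crux clause at EVERY stalk of the weighted blow-up `affineBlowup (I_N R)` of the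
weighted-homogeneous prime hypersurface `R = k[X]/(f)` along `V(X_J)` (weights positive on `J`, zero off `J`, Veronese
saturation, clause off `V(X_J)`). Proof = `gradedConeFiModelRel` (p499962) verbatim, closed by the opened E6‴
`CNConeFiModelRelBlowup.affineBlowup_fiClause_of_cover`. [folklore] -/
theorem gradedConeFiModelRel_affineBlowup (p : ℕ) [Fact p.Prime] (k : Type) [Field k] [CharP k p] (n : ℕ)
    (J : Finset (Fin n)) (hJ : J.Nonempty)
    (w : Fin n → ℕ) (N : ℕ) (c : Fin n → ℕ) (hN : 0 < N) (hwc : ∀ v ∈ J, 0 < w v ∧ c v * w v = N)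
    (hw0 : ∀ v : Fin n, v ∉ J → w v = 0)
    (hpow : ∀ (K : ℕ) (b : Fin n →₀ ℕ), K * N ≤ Finsupp.weight w b →
      (MvPolynomial.monomial b (1 : k) : MvPolynomial (Fin n) k) ∈
        (Ideal.span {m : MvPolynomial (Fin n) k | ∃ b : Fin n →₀ ℕ, N ≤ Finsupp.weight w b ∧
          m = MvPolynomial.monomial b 1}) ^ K)
    (f : MvPolynomial (Fin n) k) (D : ℕ) (hf : MvPolynomial.IsWeightedHomogeneous w f D)
    (hfprime : (Ideal.span {f}).IsPrime)
    (hXne : ∀ v : Fin n, Ideal.Quotient.mk (Ideal.span {f}) (MvPolynomial.X v) ≠ 0)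
    (hoff : ∀ (Q : Ideal (MvPolynomial (Fin n) k ⧸ Ideal.span {f})) [Q.IsMaximal],
      (∃ j ∈ J, Ideal.Quotient.mk (Ideal.span {f}) (MvPolynomial.X j) ∉ Q) →
      ∀ d : ℕ, ringKrullDim (Localization.AtPrime Q) = d → ∀ s : Fin d → Localization.AtPrime Q,
        (Ideal.span (Set.range s)).radical.IsMaximal →
          RingTheory.Sequence.IsWeaklyRegular (Localization.AtPrime Q) (List.ofFn s) ∧
          ∀ y : Localization.AtPrime Q, (∃ e : ℕ, y ^ p ^ e ∈ Ideal.span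
            ((fun z : Localization.AtPrime Q => z ^ p ^ e) ''
              (Ideal.span (Set.range s) : Set (Localization.AtPrime Q)))) → y ∈ Ideal.span (Set.range s)) :
    ∀ y : ↥(affineBlowup ((Ideal.span {m : MvPolynomial (Fin n) k | ∃ b : Fin n →₀ ℕ, N ≤ Finsupp.weight w b ∧
        m = MvPolynomial.monomial b 1}).map (Ideal.Quotient.mk (Ideal.span {f})))), IsDomain ((affineBlowup ((Ideal.span {m : MvPolynomial (Fin n) k | ∃ b : Fin n →₀ ℕ, N ≤ Finsupp.weight w b ∧
        m = MvPolynomial.monomial b 1}).map (Ideal.Quotient.mk (Ideal.span {f})))).presheaf.stalk y) ∧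
      ∀ d : ℕ, ringKrullDim ((affineBlowup ((Ideal.span {m : MvPolynomial (Fin n) k | ∃ b : Fin n →₀ ℕ, N ≤ Finsupp.weight w b ∧
        m = MvPolynomial.monomial b 1}).map (Ideal.Quotient.mk (Ideal.span {f})))).presheaf.stalk y) = d →
        ∀ s : Fin d → (affineBlowup ((Ideal.span {m : MvPolynomial (Fin n) k | ∃ b : Fin n →₀ ℕ, N ≤ Finsupp.weight w b ∧
        m = MvPolynomial.monomial b 1}).map (Ideal.Quotient.mk (Ideal.span {f})))).presheaf.stalk y, (Ideal.span (Set.range s)).radical.IsMaximal →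
          RingTheory.Sequence.IsWeaklyRegular ((affineBlowup ((Ideal.span {m : MvPolynomial (Fin n) k | ∃ b : Fin n →₀ ℕ, N ≤ Finsupp.weight w b ∧
        m = MvPolynomial.monomial b 1}).map (Ideal.Quotient.mk (Ideal.span {f})))).presheaf.stalk y) (List.ofFn s) ∧
          ∀ z : (affineBlowup ((Ideal.span {m : MvPolynomial (Fin n) k | ∃ b : Fin n →₀ ℕ, N ≤ Finsupp.weight w b ∧
        m = MvPolynomial.monomial b 1}).map (Ideal.Quotient.mk (Ideal.span {f})))).presheaf.stalk y, (∃ e : ℕ, z ^ p ^ e ∈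
              Ideal.span ((fun w : (affineBlowup ((Ideal.span {m : MvPolynomial (Fin n) k | ∃ b : Fin n →₀ ℕ, N ≤ Finsupp.weight w b ∧
        m = MvPolynomial.monomial b 1}).map (Ideal.Quotient.mk (Ideal.span {f})))).presheaf.stalk y => w ^ p ^ e) ''
                (Ideal.span (Set.range s) : Set ((affineBlowup ((Ideal.span {m : MvPolynomial (Fin n) k | ∃ b : Fin n →₀ ℕ, N ≤ Finsupp.weight w b ∧
        m = MvPolynomial.monomial b 1}).map (Ideal.Quotient.mk (Ideal.span {f})))).presheaf.stalk y)))) →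
            z ∈ Ideal.span (Set.range s) := by
  classical
  haveI := hfprime
  -- `R = k[X]/(f)` is a Noetherian Jacobson domain of characteristic `p`
  haveI : IsDomain (MvPolynomial (Fin n) k ⧸ Ideal.span {f}) := Ideal.Quotient.isDomain _
  haveI : CharP (MvPolynomial (Fin n) k ⧸ Ideal.span {f}) p :=
    charP_of_injective_algebraMap (algebraMap k (MvPolynomial (Fin n) k ⧸ Ideal.span {f})).injective p
  obtain ⟨j₀, hj₀⟩ := hJ
  -- chart selector: the charts are the `x̄_v^{c_v}`, `v ∈ J` (indices off `J` repeat the chart of `j₀`)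
  obtain ⟨π, hπ⟩ : ∃ π : Fin n → Fin n, π = fun j => if j ∈ J then j else j₀ := ⟨_, rfl⟩
  have hπJ : ∀ j : Fin n, π j ∈ J := fun j => by
    rw [hπ]
    dsimp only
    split_ifs with h
    · exact h
    · exact hj₀
  have hπid : ∀ j ∈ J, π j = j := fun j hj => by
    rw [hπ]
    dsimp only
    rw [if_pos hj]
  -- names: the centre `I = I_N · R` and the covering family `v j = x̄_{π j} ^ c_{π j}`
  obtain ⟨I, hI⟩ : ∃ I : Ideal (MvPolynomial (Fin n) k ⧸ Ideal.span {f}),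
      I = (Ideal.span {m : MvPolynomial (Fin n) k | ∃ b : Fin n →₀ ℕ, N ≤ Finsupp.weight w b ∧
        m = MvPolynomial.monomial b 1}).map (Ideal.Quotient.mk (Ideal.span {f})) := ⟨_, rfl⟩
  obtain ⟨v, hv⟩ : ∃ v : Fin n → MvPolynomial (Fin n) k ⧸ Ideal.span {f},
      v = fun j => Ideal.Quotient.mk (Ideal.span {f}) (MvPolynomial.X (π j)) ^ c (π j) := ⟨_, rfl⟩
  have hc : ∀ j ∈ J, 0 < c j := fun j hj => Nat.pos_of_ne_zero fun h => by
    have h2 := (hwc j hj).2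
    rw [h, zero_mul] at h2
    omega
  -- `X j ^ c j ∈ I_N` for `j ∈ J`
  have hXcI : ∀ j ∈ J, (X j : MvPolynomial (Fin n) k) ^ c j ∈
      Ideal.span {m : MvPolynomial (Fin n) k | ∃ b : Fin n →₀ ℕ, N ≤ Finsupp.weight w b ∧
        m = MvPolynomial.monomial b 1} := by
    intro j hj
    rw [X_pow_eq_monomial]
    refine monomial_mem_weightIdeal w N _ ?_
    rw [Finsupp.weight_single, smul_eq_mul, (hwc j hj).2]
  -- `v j ∈ I`, `v j ≠ 0`, `I ≠ 0`
  have hvI : ∀ j : Fin n, v j ∈ I := by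
    intro j
    rw [hv, hI]
    dsimp only
    rw [← map_pow]
    exact Ideal.mem_map_of_mem _ (hXcI (π j) (hπJ j))
  have hv0 : ∀ j : Fin n, v j ≠ 0 := fun j => by
    rw [hv]
    exact pow_ne_zero _ (hXne (π j))
  have hI0 : I ≠ ⊥ := fun h => hv0 j₀ (by simpa [h] using hvI j₀)
  -- the centre lies in the ideal of the `J`-variables (weights vanish off `J`)
  have hIle : I ≤ Ideal.span ((fun j : Fin n => Ideal.Quotient.mk (Ideal.span {f}) (MvPolynomial.X j)) '' (J : Set (Fin n))) := by
    rw [hI, show ((fun j : Fin n => Ideal.Quotient.mk (Ideal.span {f}) (MvPolynomial.X j)) '' (J : Set (Fin n))) =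
      Ideal.Quotient.mk (Ideal.span {f}) '' ((fun j : Fin n => (X j : MvPolynomial (Fin n) k)) '' (J : Set (Fin n))) from
      by rw [Set.image_image], ← Ideal.map_span]
    exact Ideal.map_mono (weightIdeal_le_span_XJ J w hw0 N hN)
  -- THE COVER: every generator `x̄^b`, `wt b ≥ N`, involves some `j ∈ J`, and `(x̄^b)^{c_j} = x̄ⱼ^{c_j} · x̄^{b'}`
  have hcov : (HomogeneousIdeal.irrelevant (reesGrading I)).toIdeal ≤
      (Ideal.span (Set.range fun j : Fin n => reesT (I := I) (v j) (hvI j))).radical := by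
    refine ReesCoverOfPowers.stub_reesCoverOfPowers _ I
      (Ideal.Quotient.mk (Ideal.span {f}) '' {m : MvPolynomial (Fin n) k | ∃ b : Fin n →₀ ℕ,
        N ≤ Finsupp.weight w b ∧ m = MvPolynomial.monomial b 1}) (by rw [hI, Ideal.map_span]) n v hvI ?_
    rintro _ ⟨_, ⟨b, hb, rfl⟩, rfl⟩
    -- pick a `J`-variable `j` occurring in `b`
    obtain ⟨j, hjJ, hj⟩ := exists_mem_ne_zero_of_weight_pos J w hw0 b (lt_of_lt_of_le hN hb)
    have hle : Finsupp.single j (c j) ≤ c j • b := Finsupp.single_le_iff.mpr (by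
      rw [Finsupp.smul_apply, smul_eq_mul]
      exact Nat.le_mul_of_pos_right _ (Nat.pos_of_ne_zero hj))
    have hsplit : c j • b = Finsupp.single j (c j) + (c j • b - Finsupp.single j (c j)) := by
      rw [add_comm, tsub_add_cancel_of_le hle]
    have hvj : v j = Ideal.Quotient.mk (Ideal.span {f}) (X j) ^ c j := by
      rw [hv]
      dsimp only
      rw [hπid j hjJ]
    refine ⟨j, c j, hc j hjJ, Ideal.Quotient.mk (Ideal.span {f})
      (MvPolynomial.monomial (c j • b - Finsupp.single j (c j)) 1), ?_, ?_⟩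
    · -- `x̄^{b'} ∈ I ^ (c_j - 1)` by the Veronese saturation hypothesis
      rw [hI, ← Ideal.map_pow]
      refine Ideal.mem_map_of_mem _ (hpow (c j - 1) _ ?_)
      have hwt : Finsupp.weight w (c j • b) =
          N + Finsupp.weight w (c j • b - Finsupp.single j (c j)) := by
        conv_lhs => rw [hsplit]
        rw [map_add, Finsupp.weight_single, smul_eq_mul, (hwc j hjJ).2]
      have hwt' : Finsupp.weight w (c j • b) = c j * Finsupp.weight w b := by
        rw [map_nsmul, smul_eq_mul]
      have h1 : c j * N ≤ c j * Finsupp.weight w b := Nat.mul_le_mul_left _ hb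
      have h2 : (c j - 1) * N + N = c j * N := by
        rcases Nat.exists_eq_succ_of_ne_zero (hc j hjJ).ne' with ⟨e, he⟩
        rw [he, Nat.succ_sub_one, Nat.succ_mul]
      omega
    · -- the identity `(x̄^b)^{c_j} = x̄ⱼ^{c_j} · x̄^{b'}`
      rw [hvj, ← map_pow (Ideal.Quotient.mk (Ideal.span {f})) (X j),
        ← map_pow (Ideal.Quotient.mk (Ideal.span {f})) (MvPolynomial.monomial b (1 : k)), ← map_mul]
      congr 1
      rw [MvPolynomial.monomial_pow, one_pow, X_pow_eq_monomial, MvPolynomial.monomial_mul, one_mul, ← hsplit]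
  -- OFF THE CENTRE (relative Jacobson step): a prime `P ⊉ I` generalises a closed point off `V(X_J)`
  have hoff' : ∀ (P : Ideal (MvPolynomial (Fin n) k ⧸ Ideal.span {f})) [P.IsPrime], ¬ I ≤ P →
      IsDomain (Localization.AtPrime P) ∧
      ∀ d : ℕ, ringKrullDim (Localization.AtPrime P) = d → ∀ s : Fin d → Localization.AtPrime P,
        (Ideal.span (Set.range s)).radical.IsMaximal →
          RingTheory.Sequence.IsWeaklyRegular (Localization.AtPrime P) (List.ofFn s) ∧
          ∀ y : Localization.AtPrime P, (∃ e : ℕ, y ^ p ^ e ∈ Ideal.span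
            ((fun z : Localization.AtPrime P => z ^ p ^ e) ''
              (Ideal.span (Set.range s) : Set (Localization.AtPrime P)))) → y ∈ Ideal.span (Set.range s) := by
    intro P _ hP
    obtain ⟨Q, hQ, hPQ, j, hjJ, hj⟩ := CNConeFiModelRel.exists_maximal_not_mem_X_of_le f J I hIle P hP
    haveI := hQ
    exact ClauseOfMaximal.fiClause_atPrime_of_le p hPQ ⟨inferInstance, hoff Q ⟨j, hjJ, hj⟩⟩
  -- ON THE EXCEPTIONAL LOCUS, chart by chart: the relative graded chart clause (p499040)
  have hon' : ∀ (j : Fin n) (Q : Ideal (blowupAlgebra I (v j))) [Q.IsMaximal],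
      algebraMap (MvPolynomial (Fin n) k ⧸ Ideal.span {f}) (blowupAlgebra I (v j)) (v j) ∈ Q →
      ∀ d : ℕ, ringKrullDim (Localization.AtPrime Q) = d → ∀ s : Fin d → Localization.AtPrime Q,
        (Ideal.span (Set.range s)).radical.IsMaximal →
          RingTheory.Sequence.IsWeaklyRegular (Localization.AtPrime Q) (List.ofFn s) ∧
          ∀ y : Localization.AtPrime Q, (∃ e : ℕ, y ^ p ^ e ∈ Ideal.span
            ((fun z : Localization.AtPrime Q => z ^ p ^ e) ''
              (Ideal.span (Set.range s) : Set (Localization.AtPrime Q)))) → y ∈ Ideal.span (Set.range s) := by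
    subst hI hv
    intro j Q _ hQ
    have ha₀ : MvPolynomial.IsWeightedHomogeneous w (MvPolynomial.X (π j) ^ c (π j) : MvPolynomial (Fin n) k) N := by
      have h := (MvPolynomial.isWeightedHomogeneous_X k w (π j)).pow (c (π j))
      rwa [smul_eq_mul, (hwc (π j) (hπJ j)).2] at h
    have huX : Ideal.Quotient.mk (Ideal.span {f}) (MvPolynomial.X (π j)) ^ c (π j) ∈
        Ideal.span ((fun j : Fin n => Ideal.Quotient.mk (Ideal.span {f}) (MvPolynomial.X j)) '' (J : Set (Fin n))) :=
      Ideal.pow_mem_of_mem _ (Ideal.subset_span (Set.mem_image_of_mem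
        (fun j : Fin n => Ideal.Quotient.mk (Ideal.span {f}) (MvPolynomial.X j)) (Finset.mem_coe.mpr (hπJ j)))) _
        (hc (π j) (hπJ j))
    exact GradedChartClauseRel.gradedChartClauseRel p k n J w f D hf hfprime N hN (MvPolynomial.X (π j) ^ c (π j)) ha₀ _
      (map_pow _ _ _) (hv0 j) huX hpow hoff Q hQ
  subst hI
  exact CNConeFiModelRelBlowup.affineBlowup_fiClause_of_cover p (MvPolynomial (Fin n) k ⧸ Ideal.span {f}) _ n v
    hvI hI0 hv0 hcov hoff' hon'

/-- **(H3-gd-rel ⇒ STRONG⁺)** For the weighted-homogeneous prime hypersurface `R = k[X]/(f)` and the point `η` of `Spec R`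
with `η.asIdeal = (x̄ⱼ : j ∈ J)` (the generic point of the stratum `V(X_J) ∩ X`; a prime e.g. when `f ∈ (X_J)`): under the
hypotheses of the relative graded engine, the `∃`-clause of the registered hole-#3 stub `stub_confinedIsoStepStrongPlus` holds
for `X₁ = Spec R` at `η` — stub-5's `strongPlusStep_of_affineBlowup` (p499685) applied to `gradedConeFiModelRel_affineBlowup`,
with `√(I_N R) = (x̄ⱼ : j ∈ J)`. [folklore] -/
theorem gradedConeFiModelRel_strongPlusStep (p : ℕ) [Fact p.Prime] (k : Type) [Field k] [CharP k p] (n : ℕ)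
    (J : Finset (Fin n)) (hJ : J.Nonempty)
    (w : Fin n → ℕ) (N : ℕ) (c : Fin n → ℕ) (hN : 0 < N) (hwc : ∀ v ∈ J, 0 < w v ∧ c v * w v = N)
    (hw0 : ∀ v : Fin n, v ∉ J → w v = 0)
    (hpow : ∀ (K : ℕ) (b : Fin n →₀ ℕ), K * N ≤ Finsupp.weight w b →
      (MvPolynomial.monomial b (1 : k) : MvPolynomial (Fin n) k) ∈
        (Ideal.span {m : MvPolynomial (Fin n) k | ∃ b : Fin n →₀ ℕ, N ≤ Finsupp.weight w b ∧
          m = MvPolynomial.monomial b 1}) ^ K)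
    (f : MvPolynomial (Fin n) k) (D : ℕ) (hf : MvPolynomial.IsWeightedHomogeneous w f D)
    (hfprime : (Ideal.span {f}).IsPrime)
    (hXne : ∀ v : Fin n, Ideal.Quotient.mk (Ideal.span {f}) (MvPolynomial.X v) ≠ 0)
    (hoff : ∀ (Q : Ideal (MvPolynomial (Fin n) k ⧸ Ideal.span {f})) [Q.IsMaximal],
      (∃ j ∈ J, Ideal.Quotient.mk (Ideal.span {f}) (MvPolynomial.X j) ∉ Q) →
      ∀ d : ℕ, ringKrullDim (Localization.AtPrime Q) = d → ∀ s : Fin d → Localization.AtPrime Q,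
        (Ideal.span (Set.range s)).radical.IsMaximal →
          RingTheory.Sequence.IsWeaklyRegular (Localization.AtPrime Q) (List.ofFn s) ∧
          ∀ y : Localization.AtPrime Q, (∃ e : ℕ, y ^ p ^ e ∈ Ideal.span
            ((fun z : Localization.AtPrime Q => z ^ p ^ e) ''
              (Ideal.span (Set.range s) : Set (Localization.AtPrime Q)))) → y ∈ Ideal.span (Set.range s))
    (η : ↥(Spec (.of (MvPolynomial (Fin n) k ⧸ Ideal.span {f}))))
    (hη : η.asIdeal = Ideal.span ((fun j : Fin n => Ideal.Quotient.mk (Ideal.span {f}) (MvPolynomial.X j)) '' (J : Set (Fin n)))) :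
    ∃ (X₂ : Scheme.{0}) (π : X₂ ⟶ Spec (.of (MvPolynomial (Fin n) k ⧸ Ideal.span {f}))), IsProper π ∧
      Literature.AlgebraicGeometry.Resolution.IsBirational π ∧
      IsIntegral X₂ ∧ (∀ x : X₂, (∀ d : ℕ, ringKrullDim (X₂.presheaf.stalk x) = d → ∀ s : Fin d → X₂.presheaf.stalk x, (Ideal.span (Set.range s)).radical.IsMaximal → RingTheory.Sequence.IsWeaklyRegular (X₂.presheaf.stalk x) (List.ofFn s))) ∧
      IsIso (π ∣_ ⟨(closure ({η} : Set ↥(Spec (.of (MvPolynomial (Fin n) k ⧸ Ideal.span {f})))))ᶜ, isClosed_closure.isOpen_compl⟩) ∧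
      ∀ x : X₂, π.base x ∈ closure ({η} : Set ↥(Spec (.of (MvPolynomial (Fin n) k ⧸ Ideal.span {f})))) → ¬ IsClosed ({x} : Set X₂) → (IsDomain (X₂.presheaf.stalk x) ∧ ∀ d : ℕ, ringKrullDim (X₂.presheaf.stalk x) = d → ∀ s : Fin d → X₂.presheaf.stalk x, (Ideal.span (Set.range s)).radical.IsMaximal → RingTheory.Sequence.IsWeaklyRegular (X₂.presheaf.stalk x) (List.ofFn s) ∧ ∀ t : X₂.presheaf.stalk x, (∃ e : ℕ, t ^ p ^ e ∈ Ideal.span ((fun z : X₂.presheaf.stalk x => z ^ p ^ e) '' (Ideal.span (Set.range s) : Set (X₂.presheaf.stalk x)))) → t ∈ Ideal.span (Set.range s)) := by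
  classical
  haveI := hfprime
  haveI : IsDomain (MvPolynomial (Fin n) k ⧸ Ideal.span {f}) := Ideal.Quotient.isDomain _
  obtain ⟨j₀, hj₀⟩ := hJ
  have hc : ∀ j ∈ J, 0 < c j := fun j hj => Nat.pos_of_ne_zero fun h => by
    have h2 := (hwc j hj).2
    rw [h, zero_mul] at h2
    omega
  -- the centre
  obtain ⟨I, hI⟩ : ∃ I : Ideal (MvPolynomial (Fin n) k ⧸ Ideal.span {f}),
      I = (Ideal.span {m : MvPolynomial (Fin n) k | ∃ b : Fin n →₀ ℕ, N ≤ Finsupp.weight w b ∧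
        m = MvPolynomial.monomial b 1}).map (Ideal.Quotient.mk (Ideal.span {f})) := ⟨_, rfl⟩
  -- `x̄ⱼ^{cⱼ} ∈ I` for `j ∈ J`, hence `I ≠ 0`
  have hXcI : ∀ j ∈ J, Ideal.Quotient.mk (Ideal.span {f}) (MvPolynomial.X j) ^ c j ∈ I := by
    intro j hj
    rw [hI, ← map_pow, X_pow_eq_monomial]
    refine Ideal.mem_map_of_mem _ (monomial_mem_weightIdeal w N _ ?_)
    rw [Finsupp.weight_single, smul_eq_mul, (hwc j hj).2]
  have hI0 : I ≠ ⊥ := fun h => by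
    have hmem := hXcI j₀ hj₀
    rw [h, Ideal.mem_bot] at hmem
    exact pow_ne_zero _ (hXne j₀) hmem
  -- `I ≤ (x̄ⱼ : j ∈ J)` (weights vanish off `J`)
  have hIle : I ≤ Ideal.span ((fun j : Fin n => Ideal.Quotient.mk (Ideal.span {f}) (MvPolynomial.X j)) '' (J : Set (Fin n))) := by
    rw [hI, show ((fun j : Fin n => Ideal.Quotient.mk (Ideal.span {f}) (MvPolynomial.X j)) '' (J : Set (Fin n))) =
      Ideal.Quotient.mk (Ideal.span {f}) '' ((fun j : Fin n => (X j : MvPolynomial (Fin n) k)) '' (J : Set (Fin n))) from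
      by rw [Set.image_image], ← Ideal.map_span]
    exact Ideal.map_mono (weightIdeal_le_span_XJ J w hw0 N hN)
  -- `√I = η`
  have hrad : I.radical = η.asIdeal := by
    apply le_antisymm
    · rw [hη]
      haveI : (Ideal.span ((fun j : Fin n => Ideal.Quotient.mk (Ideal.span {f}) (MvPolynomial.X j)) '' (J : Set (Fin n)))).IsPrime := by
        rw [← hη]; exact η.2
      exact (Ideal.IsPrime.radical_le_iff inferInstance).mpr hIle
    · rw [hη, Ideal.span_le]
      rintro _ ⟨j, hj, rfl⟩
      exact ⟨c j, hXcI j (Finset.mem_coe.mp hj)⟩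
  have hcl := gradedConeFiModelRel_affineBlowup p k n J ⟨j₀, hj₀⟩ w N c hN hwc hw0 hpow f D hf hfprime hXne hoff
  rw [← hI] at hcl
  exact StrongPlusStepOfAffineBlowup.strongPlusStep_of_affineBlowup p (MvPolynomial (Fin n) k ⧸ Ideal.span {f}) I hI0 η
    (StrongPlusStepOfAffineBlowup.supp_iff_of_radical_eq I η hrad) hcl

end Summit.ResolutionOfSingularities.ResolutionOfSingularities.Theorems.FInjectiveMacaulayfication.GradedConeFiModelRelBlowup

end
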